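import Summits.ResolutionOfSingularities.ResolutionOfSingularities.Theorems.EquisingularLiftEquisingularLiftNatDirZeroDefs
import Literature.AlgebraicGeometry.Resolution.AlterationsSectionDivisor
import Literature.AlgebraicGeometry.Resolution.RegularLocalRingsUFD
import Literature.AlgebraicGeometry.Resolution.ResolutionOfCurves
import Literature.RingTheory.UniqueFactorizationDomain.HeightOnePrimes
import Mathlib.RingTheory.Ideal.Height
import Mathlib.RingTheory.Regular.RegularSequence
import HarnessLib

/-!
# [OURS · L1 W4.5(b) · EL♮(3) · WIDTH TABLE D8, support debt S-D8-LIFT, brick (N-C1)] A REDUCED CURVE ON A REGULAR SURFACE TRACE IS AN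
# EFFECTIVE CARTIER DIVISOR ALONG ITSELF — the local-complete-intersection clause of F-88's (F) for the NODAL residue

res-L1-w45b-nose-w1 g5 (WIDTH seat D-0157 DOOR 1; S-D8-LIFT second pen under res-L1-w45b-stub-4 g14's plan `L/res-L1-w45b-stub-4/g13/S-D8-LIFT-PLAN.md`,
split of record bus 2026-08-29T04:20:51Z).  OURS; NOT a statement of any manuscript ([Hironaka2017] is a candidate under adjudication, nothing of it is
asserted); AI-written, weaker than expert review.  No `sorry`; standard axioms; DEF-FREE.  `--supports stmt-ResolutionOfSingularities-20148 --as helper`,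
counted 0.  EL♮(3) is NOT proved; resolution of singularities in positive characteristic is NOT proved.

WHY.  The door-regime nodal lift residue `NodalCurveLiftFact` (stub-4, = ✓ `NodalEmbeddedCurveLiftAt` + (D1) `dim 𝒪_{Z̃,z} = 1` + (D2)
`dim 𝒪_{Ẽ,i z} = 2` at closed `z`) is discharged through F-88's (F)-assembly (`EmbeddedLiftFact`'s shape), whose local-complete-intersection clause
asks that the ideal of `Z̃ ↪ Ẽ` be cut out, on an affine open neighbourhood of each point, by a weakly regular sequence.  For F-88 this came from
«regular in regular» (P2); for the NODAL residue `Z̃` is not regular, and the clause comes instead from «a reduced curve on a regular surface is an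
effective Cartier divisor»: at a closed point the local ring `𝒪_{Ẽ,i z}` is regular of dimension 2, hence factorial (Auslander–Buchsbaum, tree
✓ `Matsumura1987_20_3_holds`), and the ideal of `Z̃` there is radical (`Z̃` is reduced) with quotient of dimension 1, so all its minimal primes have
height one and it is principal (tree ✓ `UniqueFactorizationDomain.exists_eq_span_singleton_of_isRadical`).  Without (D1)/(D2) the clause fails
(four concurrent non-coplanar lines in `ℙ³`: embedding dimension 3 at the vertex), which is why the all-dimension residue ✓ p694677 is only a lemma
hypothesis, never a stub (bus 2026-08-29T04:20Z).

WHAT (all PROVED).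
* `exists_eq_span_singleton_of_ringKrullDim_two` — RING CORE: in a regular local ring `A` of dimension 2, a radical ideal `I` with `dim A/I = 1` is
  principal and non-zero.
* `exists_mem_span_singleton_eq_of_span_eq` — in a local ring, if the ideal spanned by a set `S` is principal and non-zero, some member of `S` generates it.
* `exists_notMem_forall_mul_eq_zero` — spreading a non-zero-divisor: `R` Noetherian, `A = R_𝔮` a domain, `j/1 ≠ 0` ⇒ one `g ∉ 𝔮` kills every
  annihilator of `j`; `isSMulRegular_algebraMap_of_isUnit` — hence `j` is a non-zero-divisor in every `R`-algebra in which `g` is a unit and whose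
  zero elements are detected by powers of… (stated for `IsLocalization.Away g`).
* `map_eq_span_singleton_of_forall_mul_eq` — `J·B = j·B` in any `R`-algebra `B` with `g` a unit, from `g·x ∈ jR` (`x ∈ J`).
* ★ `exists_stalkIdeal_ker_eq_span_singleton` — (N-C1 (a)): for `i : Z̃ ⟶ Ẽ` over `G` (`G` locally Noetherian), `Ẽ` regular along `Z̃`, (D1), (D2):
  at every CLOSED `z`, `(ker i)_{i z} = (f)` with `f ≠ 0`.
* ★★ `exists_affineOpens_isWeaklyRegular_ker` — (N-C1 (b)), F-88's (F) lci clause for `i` VERBATIM in shape (`G` also compact): every point of `Z̃`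
  has an affine open neighbourhood `U` in `Ẽ` and `rs` weakly regular on `Γ(Ẽ, U)` with `Ideal.ofList rs = (ker i)(U)` (here `rs = [j]`).
-/

set_option linter.dupNamespace false -- mandated namespace `Summit.<Summit>.<Problem>` of this single-conjunct summit

noncomputable section

open CategoryTheory AlgebraicGeometry TopologicalSpace IsLocalRing
open Literature.AlgebraicGeometry.Resolution
open AlgebraicGeometry.Scheme.IdealSheafData

namespace Summit.ResolutionOfSingularities.ResolutionOfSingularities.Cruxes.EquisingularLiftNat.Sections.NodalCurve

universe u v

/-! ## Ring core: radical ideals of codimension one in a two-dimensional regular local ring -/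

/-- **In a regular local ring of dimension `2`, a radical ideal with one-dimensional quotient is principal and non-zero** (the ring is factorial by
Auslander–Buchsbaum, every minimal prime of the ideal has height one, and a radical ideal of a Noetherian factorial domain with height-one minimal
primes is principal). [folklore; Matsumura 1987 Thm. 20.3 + Görtz–Wedhorn I Prop. B.75 (2), both tree facts] -/
theorem exists_eq_span_singleton_of_ringKrullDim_two {A : Type u} [CommRing A] [IsRegularLocalRing A]
    (hA : ringKrullDim A = ((2 : ℕ) : WithBot ℕ∞)) {I : Ideal A} (hI : I.IsRadical)
    (hAI : ringKrullDim (A ⧸ I) = ((1 : ℕ) : WithBot ℕ∞)) :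
    ∃ f : A, f ≠ 0 ∧ I = Ideal.span {f} := by
  haveI := isDomain_of_isRegularLocalRing A
  haveI : UniqueFactorizationMonoid A := IsRegularLocalRing.uniqueFactorizationMonoid A
  haveI : FiniteRingKrullDim A := by
    refine (finiteRingKrullDim_iff_ne_bot_and_top (R := A)).mpr ⟨?_, ?_⟩ <;> rw [hA] <;> decide
  -- every minimal prime of `I` has height one
  have hmin : ∀ p ∈ I.minimalPrimes, p.height = 1 := by
    intro p hp
    haveI : p.IsPrime := hp.1.1
    have hIp : I ≤ p := hp.1.2
    have hle : (p.height : WithBot ℕ∞) ≤ ((2 : ℕ) : WithBot ℕ∞) := hA ▸ Ideal.height_le_ringKrullDim_of_isPrime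
    have hle' : p.height ≤ ((2 : ℕ) : ℕ∞) := WithBot.coe_le_coe.mp hle
    have hne : p.height ≠ ⊤ := ne_top_of_le_ne_top (ENat.coe_ne_top 2) hle'
    obtain ⟨n, hn⟩ := ENat.ne_top_iff_exists.mp hne
    rw [← hn] at hle'
    have hn2 : n ≤ 2 := ENat.coe_le_coe.mp hle'
    interval_cases n
    · -- height 0: `p = ⊥`, so `I = ⊥` and `dim A/I = 2`
      exfalso
      have hp0 : p = ⊥ := Ideal.height_eq_zero_iff_eq_bot.mp (by rw [← hn]; simp)
      have hI0 : I = ⊥ := le_bot_iff.mp (hp0 ▸ hIp)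
      subst hI0
      have h2 : ringKrullDim (A ⧸ (⊥ : Ideal A)) = ringKrullDim A := ringKrullDim_eq_of_ringEquiv (RingEquiv.quotientBot A)
      rw [hAI, hA] at h2
      exact absurd (ENat.coe_inj.mp (WithBot.coe_eq_coe.mp h2)) (by decide)
    · rw [← hn]; simp
    · -- height 2: `p = 𝔪` is minimal over the radical `I`, so `I = 𝔪` and `dim A/I = 0`
      exfalso
      have hpm : p = maximalIdeal A := (Ideal.height_eq_ringKrullDim_iff (I := p)).mp (by rw [hA, ← hn]; rfl)
      have hIm : I = maximalIdeal A := by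
        refine le_antisymm (hpm ▸ hIp) ?_
        rw [← hI.radical, Ideal.radical_eq_sInf]
        refine le_sInf fun J hJ => ?_
        haveI : J.IsPrime := hJ.2
        have hJm : J ≤ maximalIdeal A := IsLocalRing.le_maximalIdeal hJ.2.ne_top
        exact hpm ▸ hp.2 ⟨hJ.2, hJ.1⟩ (hpm ▸ hJm)
      subst hIm
      letI := Ideal.Quotient.field (maximalIdeal A)
      have h0 : ringKrullDim (A ⧸ maximalIdeal A) = 0 := ringKrullDim_eq_zero_of_field _
      rw [hAI] at h0
      exact absurd (ENat.coe_inj.mp (WithBot.coe_eq_coe.mp (h0.trans (Nat.cast_zero (R := WithBot ℕ∞)).symm))) (by decide)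
  obtain ⟨f, hf⟩ := Literature.RingTheory.UniqueFactorizationDomain.exists_eq_span_singleton_of_isRadical hI hmin
  refine ⟨f, ?_, hf⟩
  rintro rfl
  rw [Ideal.span_singleton_zero] at hf
  subst hf
  have h2 : ringKrullDim (A ⧸ (⊥ : Ideal A)) = ringKrullDim A := ringKrullDim_eq_of_ringEquiv (RingEquiv.quotientBot A)
  rw [hAI, hA] at h2
  exact absurd (ENat.coe_inj.mp (WithBot.coe_eq_coe.mp h2)) (by decide)


/-- **In a local ring, if a set spans a non-zero principal ideal then some member of the set generates it** (if every member were a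
non-unit multiple of the generator `f`, then `f ∈ 𝔪·(f)`, so `(1 − m) f = 0` with `1 − m` a unit). [folklore] -/
theorem exists_mem_span_singleton_eq {A : Type u} [CommRing A] [IsLocalRing A] {S : Set A} {f : A} (hf : f ≠ 0)
    (hS : Ideal.span S = Ideal.span {f}) : ∃ s ∈ S, Ideal.span {s} = Ideal.span {f} := by
  by_contra h
  push Not at h
  have hle : Ideal.span S ≤ maximalIdeal A * Ideal.span {f} := by
    rw [Ideal.span_le]
    intro s hs
    have hsf : s ∈ Ideal.span {f} := hS ▸ Ideal.subset_span hs
    obtain ⟨a, rfl⟩ := Ideal.mem_span_singleton'.mp hsf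
    have ha : a ∈ maximalIdeal A := by
      by_contra hau
      have hu : IsUnit a := by
        rw [IsLocalRing.mem_maximalIdeal, mem_nonunits_iff, not_not] at hau
        exact hau
      exact h (a * f) hs (Ideal.span_singleton_mul_left_unit hu f)
    exact Ideal.mul_mem_mul ha (Ideal.mem_span_singleton_self f)
  have hf' : f ∈ maximalIdeal A * Ideal.span {f} := hle (hS ▸ Ideal.mem_span_singleton_self f)
  obtain ⟨m, hm, hmf⟩ := Ideal.mem_mul_span_singleton.mp hf'
  have hu : IsUnit (1 - m) := IsLocalRing.isUnit_one_sub_self_of_mem_nonunits m hm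
  apply hf
  have h0 : (1 - m) * f = 0 := by rw [sub_mul, one_mul, hmf, sub_self]
  exact (hu.mul_right_eq_zero).mp h0

/-! ## Spreading out: a generator and a non-zero-divisor on a basic open neighbourhood -/

/-- **Spreading a non-zero-divisor from the local ring**: `R` Noetherian, `A = R_𝔮` a domain, `j/1 ≠ 0` in `A`; then a single `g ∉ 𝔮` kills every
annihilator of `j` (the annihilator is finitely generated and dies in `A`). [folklore] -/
theorem exists_notMem_forall_mul_eq_zero {R : Type u} [CommRing R] [IsNoetherianRing R] (q : Ideal R) [q.IsPrime]
    {A : Type v} [CommRing A] [Algebra R A] [IsLocalization.AtPrime A q] [IsDomain A] {j : R} (hj : algebraMap R A j ≠ 0) :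
    ∃ g ∉ q, ∀ a : R, a * j = 0 → g * a = 0 := by
  classical
  let K : Submodule R R := LinearMap.ker (LinearMap.mulRight R j)
  have hK : ∀ a : R, a ∈ K ↔ a * j = 0 := fun a => by
    simp only [K, LinearMap.mem_ker, LinearMap.mulRight_apply]
  obtain ⟨s, hs⟩ : K.FG := IsNoetherian.noetherian K
  have ht : ∀ a ∈ s, ∃ t : q.primeCompl, (t : R) * a = 0 := by
    intro a ha
    have haK : a ∈ K := hs ▸ Submodule.subset_span ha
    have haj : a * j = 0 := (hK a).mp haK
    have h0 : algebraMap R A a = 0 := by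
      have h := congrArg (algebraMap R A) haj
      rw [map_mul, map_zero] at h
      exact (mul_eq_zero.mp h).resolve_right hj
    exact (IsLocalization.map_eq_zero_iff q.primeCompl A a).mp h0
  choose! t ht using ht
  refine ⟨∏ a ∈ s, (t a : R), ?_, ?_⟩
  · have hmem : (∏ a ∈ s, (t a : R)) ∈ q.primeCompl := Submonoid.prod_mem _ fun a ha => (t a).2
    exact hmem
  · intro a haj
    have haK : a ∈ Submodule.span R (s : Set R) := hs.symm ▸ (hK a).mpr haj
    refine Submodule.span_induction (p := fun a _ => (∏ x ∈ s, (t x : R)) * a = 0) ?_ (by simp) ?_ ?_ haK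
    · intro x hxs
      obtain ⟨c, hc⟩ : (t x : R) ∣ ∏ y ∈ s, (t y : R) := Finset.dvd_prod_of_mem _ hxs
      rw [hc, mul_comm ((t x : R)) c, mul_assoc, ht x hxs, mul_zero]
    · intro x y _ _ hx hy
      rw [mul_add, hx, hy, add_zero]
    · intro c x _ hx
      rw [smul_eq_mul, mul_left_comm, hx, mul_zero]

/-- … hence `j` is a NON-ZERO-DIVISOR in the localisation away from such a `g`. [folklore] -/
theorem isSMulRegular_algebraMap_of_away {R : Type u} [CommRing R] {j g : R} (H : ∀ a : R, a * j = 0 → g * a = 0)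
    {B : Type v} [CommRing B] [Algebra R B] [IsLocalization.Away g B] : IsSMulRegular B (algebraMap R B j) := by
  rw [isSMulRegular_iff_right_eq_zero_of_smul]
  intro x hx
  rw [smul_eq_mul] at hx
  obtain ⟨⟨a, s⟩, rfl⟩ := IsLocalization.mk'_surjective (Submonoid.powers g) x
  have h0 : algebraMap R B (a * j) = 0 := by
    rw [map_mul, ← IsLocalization.mk'_spec B a s, mul_right_comm, mul_comm (IsLocalization.mk' B a s), hx, zero_mul]
  obtain ⟨⟨m, hm⟩, hma⟩ := (IsLocalization.map_eq_zero_iff (Submonoid.powers g) B (a * j)).mp h0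
  obtain ⟨k, rfl⟩ := (Submonoid.mem_powers_iff _ _).mp hm
  have h1 : g ^ (k + 1) * a = 0 := by
    have := H (g ^ k * a) (by rw [mul_assoc]; exact hma)
    rw [pow_succ', mul_assoc]; exact this
  exact (IsLocalization.mk'_eq_zero_iff a s).mpr ⟨⟨g ^ (k + 1), Submonoid.pow_mem _ (Submonoid.mem_powers g) _⟩, h1⟩

/-- **`J·B = j·B` in an `R`-algebra `B` where `g` is a unit**, from `g x ∈ jR` for all `x ∈ J` and `j ∈ J` (the `Away` variant of tree
✓ `UniqueFactorizationDomain.map_eq_span_of_forall_mul_eq`). [folklore] -/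
theorem map_eq_span_singleton_of_forall_mul_eq {R : Type u} [CommRing R] {J : Ideal R} {j g : R} (hj : j ∈ J)
    (H : ∀ x ∈ J, ∃ a : R, g * x = j * a) {B : Type v} [CommRing B] [Algebra R B] (hg : IsUnit (algebraMap R B g)) :
    J.map (algebraMap R B) = Ideal.span {algebraMap R B j} := by
  apply le_antisymm
  · rw [Ideal.map_le_iff_le_comap]
    intro x hx
    obtain ⟨a, ha⟩ := H x hx
    rw [Ideal.mem_comap, Ideal.mem_span_singleton']
    refine ⟨algebraMap R B a * ↑hg.unit⁻¹, ?_⟩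
    calc algebraMap R B a * ↑hg.unit⁻¹ * algebraMap R B j
        = ↑hg.unit⁻¹ * algebraMap R B (j * a) := by rw [map_mul]; ring
      _ = ↑hg.unit⁻¹ * algebraMap R B (g * x) := by rw [ha]
      _ = ↑hg.unit⁻¹ * (↑hg.unit * algebraMap R B x) := by rw [map_mul, IsUnit.unit_spec]
      _ = algebraMap R B x := by rw [← mul_assoc, Units.inv_mul, one_mul]
  · rw [Ideal.span_singleton_le_iff_mem]
    exact Ideal.mem_map_of_mem _ hj

/-! ## (N-C1 (a)) The stalk ideal of `Z̃` in `Ẽ` at a closed point is principal -/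

/-- ★ **(N-C1 (a)) A REDUCED CURVE ON A REGULAR SURFACE TRACE IS CARTIER AT EVERY CLOSED POINT.**  For the closed immersion `i : Z̃ ⟶ Ẽ` of reduced
closed subschemes of `G` (`i ≫ ι_E = ι_Z`), with `Ẽ` regular along `Z̃`, (D2) `dim 𝒪_{Ẽ,i z} = 2` and (D1) `dim 𝒪_{Z̃,z} = 1` at closed `z`: the stalk of
the ideal sheaf of `i` at `i z` is generated by ONE non-zero element.  (The stalk is a regular local ring of dimension 2, hence factorial; the ideal is the
kernel of `𝒪_{Ẽ,i z} ↠ 𝒪_{Z̃,z}`, radical since `Z̃` is reduced, with quotient of dimension 1.) [folklore; every characteristic] -/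
theorem exists_stalkIdeal_ker_eq_span_singleton {G : Scheme.{0}} {Z E : Set G} (hZ : IsClosed Z) (hE : IsClosed E)
    (i : redSub G Z hZ ⟶ redSub G E hE) (hi : i ≫ redSubι G E hE = redSubι G Z hZ)
    (hEreg : ∀ x : ↥(redSub G Z hZ), IsRegularLocalRing ((redSub G E hE).presheaf.stalk (i x)))
    (hEdim : ∀ z : ↥(redSub G Z hZ), IsClosed ({z} : Set ↥(redSub G Z hZ)) →
      ringKrullDim ((redSub G E hE).presheaf.stalk (i z)) = ((2 : ℕ) : WithBot ℕ∞))
    (hZdim : ∀ z : ↥(redSub G Z hZ), IsClosed ({z} : Set ↥(redSub G Z hZ)) →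
      ringKrullDim ((redSub G Z hZ).presheaf.stalk z) = ((1 : ℕ) : WithBot ℕ∞))
    (z : ↥(redSub G Z hZ)) (hz : IsClosed ({z} : Set ↥(redSub G Z hZ))) :
    ∃ f : (redSub G E hE).presheaf.stalk (i z), f ≠ 0 ∧ stalkIdeal i.ker (i z) = Ideal.span {f} := by
  haveI : IsClosedImmersion (i ≫ redSubι G E hE) := by rw [hi]; infer_instance
  haveI : IsClosedImmersion i := IsClosedImmersion.of_comp_isClosedImmersion i (redSubι G E hE)
  haveI := hEreg z
  -- the stalk ideal is the kernel of the (surjective) stalk map, whose target `𝒪_{Z̃,z}` is reduced of dimension 1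
  have hker : stalkIdeal i.ker (i z) = RingHom.ker (i.stalkMap z).hom := stalkIdeal_ker_eq_ker_stalkMap i z
  have hsurj : Function.Surjective (i.stalkMap z).hom := i.stalkMap_surjective z
  let e : ((redSub G E hE).presheaf.stalk (i z)) ⧸ RingHom.ker (i.stalkMap z).hom ≃+* (redSub G Z hZ).presheaf.stalk z :=
    RingHom.quotientKerEquivOfSurjective hsurj
  haveI : IsReduced (redSub G Z hZ) := isReduced_subscheme_vanishingIdeal ⟨Z, hZ⟩
  have hrad : (RingHom.ker (i.stalkMap z).hom).IsRadical := by
    rw [Ideal.isRadical_iff_quotient_reduced]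
    exact isReduced_of_injective e e.injective
  have hdim : ringKrullDim (((redSub G E hE).presheaf.stalk (i z)) ⧸ RingHom.ker (i.stalkMap z).hom) = ((1 : ℕ) : WithBot ℕ∞) := by
    rw [ringKrullDim_eq_of_ringEquiv e]; exact hZdim z hz
  obtain ⟨f, hf0, hf⟩ := exists_eq_span_singleton_of_ringKrullDim_two (hEdim z hz) hrad hdim
  exact ⟨f, hf0, hker.trans hf⟩

/-! ## (N-C1 (b)) The local-complete-intersection clause of F-88's (F) for `i : Z̃ ⟶ Ẽ` -/

/-- ★★ **(N-C1 (b)) THE lci CLAUSE OF (F) FOR THE NODAL RESIDUE**: under (D1), (D2) and «`Ẽ` regular along `Z̃`» (with `G` locally Noetherian and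
quasi-compact), every point of `Z̃` has an affine open neighbourhood `U` in `Ẽ` on which the ideal of `Z̃` is generated by ONE NON-ZERO-DIVISOR
`j ∈ Γ(Ẽ, U)` — i.e. by the weakly regular sequence `[j]`, F-88's `EmbeddedLiftFact` clause VERBATIM in shape.  (Closed points suffice since open
sets are stable under generisation; at a closed point, (a) gives a generator of the stalk ideal, which is spread — generator AND non-zero-divisor —
to a basic open neighbourhood by Noetherian finiteness.) [folklore; every characteristic] -/
theorem exists_affineOpens_isWeaklyRegular_ker {G : Scheme.{0}} [IsLocallyNoetherian G] [CompactSpace G]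
    {Z E : Set G} (hZ : IsClosed Z) (hE : IsClosed E)
    (i : redSub G Z hZ ⟶ redSub G E hE) (hi : i ≫ redSubι G E hE = redSubι G Z hZ)
    (hEreg : ∀ x : ↥(redSub G Z hZ), IsRegularLocalRing ((redSub G E hE).presheaf.stalk (i x)))
    (hEdim : ∀ z : ↥(redSub G Z hZ), IsClosed ({z} : Set ↥(redSub G Z hZ)) →
      ringKrullDim ((redSub G E hE).presheaf.stalk (i z)) = ((2 : ℕ) : WithBot ℕ∞))
    (hZdim : ∀ z : ↥(redSub G Z hZ), IsClosed ({z} : Set ↥(redSub G Z hZ)) →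
      ringKrullDim ((redSub G Z hZ).presheaf.stalk z) = ((1 : ℕ) : WithBot ℕ∞)) :
    ∀ z : ↥(redSub G Z hZ), ∃ U : (redSub G E hE).affineOpens, i.base z ∈ (U : (redSub G E hE).Opens) ∧
      ∃ rs : List Γ(redSub G E hE, U), RingTheory.Sequence.IsWeaklyRegular Γ(redSub G E hE, U) rs ∧ Ideal.ofList rs = i.ker.ideal U := by
  classical
  haveI : IsClosedImmersion (i ≫ redSubι G E hE) := by rw [hi]; infer_instance
  haveI : IsClosedImmersion i := IsClosedImmersion.of_comp_isClosedImmersion i (redSubι G E hE)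
  haveI : IsLocallyNoetherian (redSub G E hE) := LocallyOfFiniteType.isLocallyNoetherian (redSubι G E hE)
  -- closed points suffice
  haveI : CompactSpace ↥(redSub G Z hZ) := QuasiCompact.compactSpace_of_compactSpace (redSubι G Z hZ)
  suffices hcl : ∀ z₀ : ↥(redSub G Z hZ), IsClosed ({z₀} : Set ↥(redSub G Z hZ)) →
      ∃ U : (redSub G E hE).affineOpens, i.base z₀ ∈ (U : (redSub G E hE).Opens) ∧
        ∃ rs : List Γ(redSub G E hE, U), RingTheory.Sequence.IsWeaklyRegular Γ(redSub G E hE, U) rs ∧ Ideal.ofList rs = i.ker.ideal U by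
    intro z
    obtain ⟨z₀, hz₀, hcl₀⟩ := (isClosed_closure (s := ({z} : Set ↥(redSub G Z hZ)))).exists_closed_singleton ⟨z, subset_closure rfl⟩
    have hzz₀ : z ⤳ z₀ := specializes_iff_mem_closure.mpr hz₀
    obtain ⟨U, hU, rs, hrs⟩ := hcl z₀ hcl₀
    exact ⟨U, (hzz₀.map i.continuous).mem_open U.1.isOpen hU, rs, hrs⟩
  intro z₀ hz₀
  -- (a) at the closed point
  obtain ⟨f, hf0, hf⟩ := exists_stalkIdeal_ker_eq_span_singleton hZ hE i hi hEreg hEdim hZdim z₀ hz₀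
  haveI := hEreg z₀
  haveI := isDomain_of_isRegularLocalRing ((redSub G E hE).presheaf.stalk (i z₀))
  -- an affine open neighbourhood `U₀`, its (Noetherian) ring `R`, the prime `𝔮` of `i z₀`, and the stalk as `R_𝔮`
  obtain ⟨U₀, hU₀, hxU₀, -⟩ := exists_isAffineOpen_mem_and_subset (X := redSub G E hE) (x := i z₀) (U := ⊤) (Opens.mem_top _)
  letI := TopCat.Presheaf.algebra_section_stalk (redSub G E hE).presheaf (⟨i z₀, hxU₀⟩ : (U₀ : (redSub G E hE).Opens))
  haveI := hU₀.isLocalization_stalk ⟨i z₀, hxU₀⟩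
  set 𝔮 := (hU₀.primeIdealOf ⟨i z₀, hxU₀⟩).asIdeal with h𝔮
  have halg : ∀ a : Γ(redSub G E hE, U₀), algebraMap Γ(redSub G E hE, U₀) ((redSub G E hE).presheaf.stalk (i z₀)) a =
      ((redSub G E hE).presheaf.germ U₀ (i z₀) hxU₀).hom a := fun a => rfl
  set J : Ideal Γ(redSub G E hE, U₀) := i.ker.ideal ⟨U₀, hU₀⟩ with hJ
  -- the stalk ideal is `J · R_𝔮 = (f)`; pick `j ∈ J` whose germ generates it
  have hJf : J.map (algebraMap Γ(redSub G E hE, U₀) ((redSub G E hE).presheaf.stalk (i z₀))) = Ideal.span {f} := by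
    rw [← hf, stalkIdeal_eq_map_germ i.ker ⟨U₀, hU₀⟩ hxU₀]; rfl
  obtain ⟨s, ⟨j, hjJ, rfl⟩, hsj⟩ := exists_mem_span_singleton_eq
    (S := ⇑(algebraMap Γ(redSub G E hE, U₀) ((redSub G E hE).presheaf.stalk (i z₀))) '' (J : Set Γ(redSub G E hE, U₀))) hf0
    (by rw [← hJf]; rfl)
  have hjJ' : j ∈ J := hjJ
  have hj0 : algebraMap Γ(redSub G E hE, U₀) ((redSub G E hE).presheaf.stalk (i z₀)) j ≠ 0 := by
    intro h0; apply hf0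
    rw [← Ideal.span_singleton_eq_bot, ← hsj, Ideal.span_singleton_eq_bot]; exact h0
  -- spread the generator: `g₁ ∉ 𝔮` with `g₁ x ∈ jR` for `x ∈ J`
  have hJle : J.map (algebraMap Γ(redSub G E hE, U₀) ((redSub G E hE).presheaf.stalk (i z₀))) ≤
      Ideal.span {algebraMap Γ(redSub G E hE, U₀) ((redSub G E hE).presheaf.stalk (i z₀)) j} := by
    rw [hJf, ← hsj]
  haveI : IsNoetherianRing Γ(redSub G E hE, U₀) := IsLocallyNoetherian.component_noetherian ⟨U₀, hU₀⟩
  obtain ⟨g₁, hg₁, H₁⟩ := Literature.RingTheory.UniqueFactorizationDomain.exists_notMem_forall_mul_mem_of_fg (q := 𝔮)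
    (IsNoetherian.noetherian J) (Literature.RingTheory.UniqueFactorizationDomain.exists_mul_eq_of_map_le_span hJle)
  -- spread the non-zero-divisor: `g₂ ∉ 𝔮` killing the annihilator of `j`
  obtain ⟨g₂, hg₂, H₂⟩ := exists_notMem_forall_mul_eq_zero 𝔮 (A := (redSub G E hE).presheaf.stalk (i z₀)) hj0
  -- the basic open `D(g₁ g₂) ∋ i z₀`
  have hgq : g₁ * g₂ ∉ 𝔮 := fun h => ((inferInstance : 𝔮.IsPrime).mem_or_mem h).elim hg₁ hg₂
  have hxg : (i z₀ : ↥(redSub G E hE)) ∈ (redSub G E hE).basicOpen (g₁ * g₂) := by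
    rw [(redSub G E hE).mem_basicOpen (g₁ * g₂) (i z₀) hxU₀]
    exact (IsLocalization.AtPrime.isUnit_to_map_iff ((redSub G E hE).presheaf.stalk (i z₀)) 𝔮 (g₁ * g₂)).mpr hgq
  haveI := hU₀.isLocalization_basicOpen (g₁ * g₂)
  refine ⟨(redSub G E hE).affineBasicOpen (U := ⟨U₀, hU₀⟩) (g₁ * g₂), hxg,
    [algebraMap Γ(redSub G E hE, U₀) Γ(redSub G E hE, (redSub G E hE).basicOpen (g₁ * g₂)) j], ?_, ?_⟩
  · -- `[j]` is weakly regular on `Γ(D(g₁ g₂))`: `j` is a non-zero-divisor there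
    show RingTheory.Sequence.IsWeaklyRegular Γ(redSub G E hE, (redSub G E hE).basicOpen (g₁ * g₂))
      [algebraMap Γ(redSub G E hE, U₀) Γ(redSub G E hE, (redSub G E hE).basicOpen (g₁ * g₂)) j]
    rw [RingTheory.Sequence.isWeaklyRegular_singleton_iff]
    exact isSMulRegular_algebraMap_of_away (g := g₁ * g₂) (fun a ha => by rw [mul_assoc, H₂ a ha, mul_zero])
  · -- `(ker i)(D(g₁ g₂)) = J · Γ(D(g₁ g₂)) = (j)`
    have hunit : IsUnit (algebraMap Γ(redSub G E hE, U₀) Γ(redSub G E hE, (redSub G E hE).basicOpen (g₁ * g₂)) (g₁ * g₂)) :=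
      IsLocalization.Away.algebraMap_isUnit (g₁ * g₂)
    have hmap := map_eq_span_singleton_of_forall_mul_eq hjJ' (fun x hx => by
      obtain ⟨a, ha⟩ := H₁ x hx
      exact ⟨g₂ * a, by rw [mul_assoc, mul_comm g₂ x, ← mul_assoc, ha]; ring⟩) hunit
    have h3 := i.ker.map_ideal_basicOpen ⟨U₀, hU₀⟩ (g₁ * g₂)
    show Ideal.ofList [algebraMap Γ(redSub G E hE, U₀) Γ(redSub G E hE, (redSub G E hE).basicOpen (g₁ * g₂)) j] =
      i.ker.ideal ((redSub G E hE).affineBasicOpen (U := ⟨U₀, hU₀⟩) (g₁ * g₂))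
    rw [Ideal.ofList_singleton]
    exact hmap.symm.trans h3

end Summit.ResolutionOfSingularities.ResolutionOfSingularities.Cruxes.EquisingularLiftNat.Sections.NodalCurve

end
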